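import Summits.CriticalPhenomena.PercolationContinuityZ3.Theorems.PercTreeValueEquilateralAntiFactorisationFlow
import Summits.CriticalPhenomena.PercolationContinuityZ3.Theorems.PercTreeValueEquilateralAntiFactorisationAnchor
import Summits.CriticalPhenomena.PercolationContinuityZ3.Theses.PercTreeValue
import HarnessLib

/-!
# Certificate: `EquilateralAntiFactorisation` ⟺ the window pivotal deficit (stmt-CriticalPhenomena-7800,
# line `Sketch`)

The crux `PercTreeValue.EquilateralAntiFactorisation` (`∃ δ > 0, r₀: ∀ r ≥ r₀,
(1+δ) τ(0,a_r) τ(a_r,b_r) τ(b_r,0) ≤ P_{p_c}(0 ↔ a_r ∧ 0 ↔ b_r)²` on `ℤ³`) is EQUIVALENT to the box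
form of the line's hard stub `stub_window` (C⁺ of the cards `pivotal-deficit-flow` /
`pivotal-thinning-flow`):

  `∃ ε₀ > 0, p_c + ε₀ < 1 ∧ ∃ δ > 0, ∃ r₀, ∀ r ≥ r₀, ∃ n₀, ∀ n ≥ n₀, ∫_{p_c}^{p_c+ε₀} g_{n,r}(q) dq ≤ −δ`,

where `g_{n,r} = flowIntegrand n r` is the Russo derivative of the box log-ratio
`F_{n,r} = 2 log P(T) − log P(A) − log P(B) − log P(C)` (equivalently, by
`Flow.flowIntegrand_eq_deficit`, `(1/q)` times the third-point pivotal deficit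
`Σ_P (E_q[N_P | T] − E_q[N_P | P])`).

* `infLogRatio_coe`, `tendsto_infLogRatio` — `log R_r(p₁)² → 0` for every `p₁ > p_c` (the anchor
  `stub_anchor`, i.e. pattern-blindness `connectionPatternFactorisation_proof` where `θ(p₁) > 0`);
* `EquilateralAntiFactorisation_iff_infLogRatio` — log form of the crux: `∃ c > 0, log R_r(p_c)² ≥ c`
  for all large `r`;
* `tendsto_integral_flowIntegrand` — `∫_p^{p'} g_{n,r} → log R_r(p')² − log R_r(p)²` as `n → ∞`
  (flow identity + box exhaustion at the two FIXED endpoints; no continuity in the parameter needed);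
* `EquilateralAntiFactorisation_of_window` : window ⟹ crux; `window_of_EquilateralAntiFactorisation` :
  crux ⟹ window (`ε₀ = (1−p_c)/2`); `window_iff_EquilateralAntiFactorisation` : the equivalence;
* `window_shrink` — tail localisation: the window statement for `ε₀` implies it for every
  `ε ∈ (0, ε₀]` with any smaller margin (all its mass sits at `p_c⁺`; the supercritical tail is
  removed exactly by the anchor at the two points `p_c + ε`, `p_c + ε₀`).

Consequently the line `Sketch` relocates the open content of the crux (the constant `R*² > 1` of
critical `ℤ³`, an open problem implying `θ(p_c) = 0` via `assemblyViaThreePoint`) into the sign of a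
parameter-integrated conditional pivotal covariance on `(p_c, p_c + ε]` for arbitrarily small `ε`;
it does not shrink it. All other stubs of the line (S1–S6) are landed theorems and hold in jump
worlds too.
-/

noncomputable section

namespace Summit.CriticalPhenomena.PercolationContinuityZ3.Theorems.EquilateralAntiFactorisation.Flow

open MeasureTheory Filter Topology
open Literature.Probability.Percolation Literature.Probability.LatticeModels
open Summit.CriticalPhenomena.PercolationContinuityZ3.Theses.PercTreeValue (EquilateralAntiFactorisation)

/-! ### The anchor in log form -/

/-- At a point `p > 0` of the unit interval the infinite-volume log-ratio is the logarithm of the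
squared Delfino–Viti ratio `P_p(0 ↔ a_r ∧ 0 ↔ b_r)² / (τ(0,a_r) τ(a_r,b_r) τ(b_r,0))`. -/
theorem infLogRatio_coe (p : unitInterval) (hp : 0 < (p : ℝ)) (r : ℕ) :
    infLogRatio r p =
      Real.log ((bondPercolation (zdGraph 3) p).real (openConn (0 : Site 3) ![(r : ℤ), (r : ℤ), 0] ∩
          openConn (0 : Site 3) ![(r : ℤ), 0, (r : ℤ)]) ^ 2 /
        (tau 3 p 0 ![(r : ℤ), (r : ℤ), 0] * tau 3 p ![(r : ℤ), (r : ℤ), 0] ![(r : ℤ), 0, (r : ℤ)] *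
          tau 3 p ![(r : ℤ), 0, (r : ℤ)] 0)) := by
  have hT := infT_pos r hp p.2.2
  have hA : 0 < (mu p).real (openConn 0 (ptA r)) := hT.trans_le (measureReal_mono Set.inter_subset_left)
  have hB : 0 < (mu p).real (openConn 0 (ptB r)) := hT.trans_le (measureReal_mono Set.inter_subset_right)
  have hC : 0 < (mu p).real (openConn (ptA r) (ptB r)) := hT.trans_le (measureReal_mono (infT_subset_C r))
  rw [tau_comm p (![(r : ℤ), 0, (r : ℤ)]) 0]
  simp only [tau_def, ← mu_coe]
  change infLogRatio r p = Real.log ((mu p).real (openConn 0 (ptA r) ∩ openConn 0 (ptB r)) ^ 2 /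
      ((mu p).real (openConn 0 (ptA r)) * (mu p).real (openConn (ptA r) (ptB r)) *
        (mu p).real (openConn 0 (ptB r))))
  unfold infLogRatio
  rw [Real.log_div (pow_pos hT 2).ne' (mul_pos (mul_pos hA hC) hB).ne', Real.log_pow,
    Real.log_mul (mul_pos hA hC).ne' hB.ne', Real.log_mul hA.ne' hC.ne']
  push_cast
  ring

/-- **Anchor in log form.** For every `p₁ > p_c(ℤ³)`, `log R_r(p₁)² → 0` as `r → ∞`
(`stub_anchor`: the ratio tends to `1`). -/
theorem tendsto_infLogRatio (p₁ : unitInterval) (hp₁ : criticalProbI 3 < p₁) :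
    Tendsto (fun r : ℕ => infLogRatio r p₁) atTop (𝓝 0) := by
  have hp0 : 0 < (p₁ : ℝ) := pc_pos.trans (Subtype.coe_lt_coe.mpr hp₁)
  have h := ((Real.continuousAt_log one_ne_zero).tendsto.comp (stub_anchor p₁ hp₁))
  rw [Real.log_one] at h
  exact h.congr (fun r => (infLogRatio_coe p₁ hp0 r).symm)

/-! ### The crux in log form -/

/-- **Log form of the crux.** `EquilateralAntiFactorisation` holds iff `log R_r(p_c)² ≥ c` for some
`c > 0` and all large `r` (take `c = log(1+δ)`, resp. `1 + δ = exp c`; all four probabilities are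
positive at `p_c > 0`). -/
theorem EquilateralAntiFactorisation_iff_infLogRatio :
    EquilateralAntiFactorisation ↔
      ∃ c : ℝ, 0 < c ∧ ∃ r₀ : ℕ, ∀ r : ℕ, r₀ ≤ r → c ≤ infLogRatio r (criticalProbI 3 : ℝ) := by
  have hpc0 : 0 < (criticalProbI 3 : ℝ) := pc_pos
  have hmu₀ : mu (criticalProbI 3 : ℝ) = bondPercolation (zdGraph 3) (criticalProbI 3) := mu_coe _
  -- positivity of the four probabilities at `p_c`, for every `r`
  have hT₀ : ∀ r : ℕ, 0 < (mu (criticalProbI 3 : ℝ)).real (openConn 0 (ptA r) ∩ openConn 0 (ptB r)) :=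
    fun r => infT_pos r hpc0 pc_lt_one.le
  have hA₀ : ∀ r : ℕ, 0 < (mu (criticalProbI 3 : ℝ)).real (openConn 0 (ptA r)) :=
    fun r => (hT₀ r).trans_le (measureReal_mono Set.inter_subset_left)
  have hB₀ : ∀ r : ℕ, 0 < (mu (criticalProbI 3 : ℝ)).real (openConn 0 (ptB r)) :=
    fun r => (hT₀ r).trans_le (measureReal_mono Set.inter_subset_right)
  have hC₀ : ∀ r : ℕ, 0 < (mu (criticalProbI 3 : ℝ)).real (openConn (ptA r) (ptB r)) :=
    fun r => (hT₀ r).trans_le (measureReal_mono (infT_subset_C r))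
  -- the crux, rewritten over `mu p_c`
  have key : EquilateralAntiFactorisation ↔ ∃ δ : ℝ, 0 < δ ∧ ∃ r₀ : ℕ, ∀ r : ℕ, r₀ ≤ r →
      (1 + δ) * (mu (criticalProbI 3 : ℝ)).real (openConn 0 (ptA r)) *
          (mu (criticalProbI 3 : ℝ)).real (openConn (ptA r) (ptB r)) *
          (mu (criticalProbI 3 : ℝ)).real (openConn 0 (ptB r)) ≤
        (mu (criticalProbI 3 : ℝ)).real (openConn 0 (ptA r) ∩ openConn 0 (ptB r)) ^ 2 := by
    unfold EquilateralAntiFactorisation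
    refine exists_congr fun δ => and_congr_right fun _ => exists_congr fun r₀ =>
      forall_congr' fun r => forall_congr' fun _ => ?_
    rw [tau_comm (criticalProbI 3) (![(r : ℤ), 0, (r : ℤ)]) 0]
    simp only [tau_def, ← hmu₀]
    rfl
  rw [key]
  constructor
  · rintro ⟨δ, hδ, r₀, hr⟩
    refine ⟨Real.log (1 + δ), Real.log_pos (by linarith), r₀, fun r hrr => ?_⟩
    have h := hr r hrr
    have hprod : 0 < (mu (criticalProbI 3 : ℝ)).real (openConn 0 (ptA r)) *
        (mu (criticalProbI 3 : ℝ)).real (openConn (ptA r) (ptB r)) *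
        (mu (criticalProbI 3 : ℝ)).real (openConn 0 (ptB r)) := mul_pos (mul_pos (hA₀ r) (hC₀ r)) (hB₀ r)
    have h' : (1 + δ) * ((mu (criticalProbI 3 : ℝ)).real (openConn 0 (ptA r)) *
        (mu (criticalProbI 3 : ℝ)).real (openConn (ptA r) (ptB r)) *
        (mu (criticalProbI 3 : ℝ)).real (openConn 0 (ptB r))) ≤
        (mu (criticalProbI 3 : ℝ)).real (openConn 0 (ptA r) ∩ openConn 0 (ptB r)) ^ 2 := by nlinarith [h]
    have hlog := Real.log_le_log (mul_pos (by linarith) hprod) h'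
    rw [Real.log_mul (by linarith : (1 + δ : ℝ) ≠ 0) hprod.ne',
      Real.log_mul (mul_pos (hA₀ r) (hC₀ r)).ne' (hB₀ r).ne', Real.log_mul (hA₀ r).ne' (hC₀ r).ne',
      Real.log_pow] at hlog
    unfold infLogRatio
    push_cast at hlog
    linarith
  · rintro ⟨c, hc, r₀, hr⟩
    refine ⟨Real.exp c - 1, by linarith [Real.add_one_lt_exp hc.ne'], r₀, fun r hrr => ?_⟩
    have hkey := hr r hrr
    unfold infLogRatio at hkey
    set T := (mu (criticalProbI 3 : ℝ)).real (openConn 0 (ptA r) ∩ openConn 0 (ptB r))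
    set A := (mu (criticalProbI 3 : ℝ)).real (openConn 0 (ptA r))
    set B := (mu (criticalProbI 3 : ℝ)).real (openConn 0 (ptB r))
    set C := (mu (criticalProbI 3 : ℝ)).real (openConn (ptA r) (ptB r))
    have hprod : 0 < A * C * B := mul_pos (mul_pos (hA₀ r) (hC₀ r)) (hB₀ r)
    have hexp : Real.exp c ≤ Real.exp (2 * Real.log T - Real.log A - Real.log B - Real.log C) :=
      Real.exp_le_exp.2 hkey
    have hrhs : Real.exp (2 * Real.log T - Real.log A - Real.log B - Real.log C) = T ^ 2 / (A * C * B) := by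
      have h2 : (2 : ℝ) * Real.log T = Real.log (T ^ 2) := by
        rw [Real.log_pow]; norm_num
      rw [show 2 * Real.log T - Real.log A - Real.log B - Real.log C =
        2 * Real.log T - (Real.log A + Real.log C + Real.log B) by ring, Real.exp_sub,
        ← Real.log_mul (hA₀ r).ne' (hC₀ r).ne', ← Real.log_mul (mul_pos (hA₀ r) (hC₀ r)).ne' (hB₀ r).ne',
        Real.exp_log hprod, h2, Real.exp_log (pow_pos (hT₀ r) 2)]
    rw [hrhs, le_div_iff₀ hprod] at hexp
    nlinarith [hexp]

/-! ### Box → infinite volume for the window integral -/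

/-- For `0 < p ≤ p' < 1` the window integral of the flow integrand converges, as the box exhausts
`ℤ³`, to the difference of infinite-volume log-ratios: `∫_p^{p'} g_{n,r} → log R_r(p')² − log R_r(p)²`
(flow identity in the box `Λ_n`, `n ≥ r`, and box exhaustion at the two fixed endpoints). -/
theorem tendsto_integral_flowIntegrand (r : ℕ) {p p' : ℝ} (hp : 0 < p) (hpp' : p ≤ p') (hp' : p' < 1) :
    Tendsto (fun n : ℕ => ∫ q in p..p', flowIntegrand n r q) atTop
      (𝓝 (infLogRatio r p' - infLogRatio r p)) := by
  have hlim := (tendsto_boxLogRatio r (hp.trans_le hpp') hp'.le).sub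
    (tendsto_boxLogRatio r hp (hpp'.trans hp'.le))
  refine hlim.congr' ?_
  filter_upwards [eventually_ge_atTop r] with n hn
  have hpos : ∀ q ∈ Set.Icc p p', 0 < (mu q).real (evT n r) := fun q hq =>
    evT_pos (hp.trans_le hq.1) (hq.2.trans hp'.le) hn
  exact (flow_identity n r hp hpp' hp' hpos).symm

/-! ### The certificate -/

/-- **Window deficit ⟹ crux.** If the Russo flow of the box log-ratio has mass `≤ −δ` across a
fixed upper window `[p_c, p_c + ε₀]`, uniformly in `r ≥ r₀` and in large boxes, then
`log R_r(p_c)² ≥ δ/2` for all large `r` (box exhaustion + the anchor `log R_r(p_c+ε₀)² → 0`), i.e.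
the crux holds (with `1 + δ_crux = exp(δ/2)`). -/
theorem EquilateralAntiFactorisation_of_window
    (hW : ∃ ε₀ : ℝ, 0 < ε₀ ∧ (criticalProbI 3 : ℝ) + ε₀ < 1 ∧ ∃ δ : ℝ, 0 < δ ∧ ∃ r₀ : ℕ, ∀ r : ℕ, r₀ ≤ r →
      ∃ n₀ : ℕ, ∀ n : ℕ, n₀ ≤ n →
        ∫ q in (criticalProbI 3 : ℝ)..((criticalProbI 3 : ℝ) + ε₀), flowIntegrand n r q ≤ -δ) :
    EquilateralAntiFactorisation := by
  obtain ⟨ε₀, hε₀, hε₀1, δ, hδ, r₀, hwin⟩ := hW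
  have hpc0 : 0 < (criticalProbI 3 : ℝ) := pc_pos
  rw [EquilateralAntiFactorisation_iff_infLogRatio]
  -- the anchor parameter `p₁ = p_c + ε₀ ∈ (p_c, 1)`: eventually `-δ/2 < log R_r(p₁)²`
  set p₁ : unitInterval := ⟨(criticalProbI 3 : ℝ) + ε₀, ⟨by linarith, hε₀1.le⟩⟩ with hp₁_def
  have hp₁ : criticalProbI 3 < p₁ := by
    rw [← Subtype.coe_lt_coe]
    show (criticalProbI 3 : ℝ) < (criticalProbI 3 : ℝ) + ε₀
    linarith
  obtain ⟨r₁, hr₁⟩ := eventually_atTop.1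
    ((tendsto_infLogRatio p₁ hp₁).eventually_const_lt (by linarith : -(δ / 2) < (0 : ℝ)))
  refine ⟨δ / 2, by linarith, max r₀ r₁, fun r hr => ?_⟩
  obtain ⟨n₀, hn₀⟩ := hwin r (le_of_max_le_left hr)
  -- box exhaustion of the window integral
  have hle : infLogRatio r ((criticalProbI 3 : ℝ) + ε₀) - infLogRatio r (criticalProbI 3 : ℝ) ≤ -δ :=
    le_of_tendsto (tendsto_integral_flowIntegrand r hpc0 (by linarith) hε₀1)
      (eventually_atTop.2 ⟨n₀, hn₀⟩)
  have hanch : -(δ / 2) < infLogRatio r ((criticalProbI 3 : ℝ) + ε₀) := hr₁ r (le_of_max_le_right hr)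
  linarith

/-- **Crux ⟹ window deficit.** Conversely the crux implies the window statement, with window
`ε₀ = (1 − p_c)/2` and margin `c/4` where `c = log(1+δ)`: the anchor bounds `log R_r(p_c+ε₀)² < c/2`
eventually, the crux gives `log R_r(p_c)² ≥ c`, and box exhaustion transports the difference to
every large box, where it is the flow integral. -/
theorem window_of_EquilateralAntiFactorisation (h : EquilateralAntiFactorisation) :
    ∃ ε₀ : ℝ, 0 < ε₀ ∧ (criticalProbI 3 : ℝ) + ε₀ < 1 ∧ ∃ δ : ℝ, 0 < δ ∧ ∃ r₀ : ℕ, ∀ r : ℕ, r₀ ≤ r →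
      ∃ n₀ : ℕ, ∀ n : ℕ, n₀ ≤ n →
        ∫ q in (criticalProbI 3 : ℝ)..((criticalProbI 3 : ℝ) + ε₀), flowIntegrand n r q ≤ -δ := by
  rw [EquilateralAntiFactorisation_iff_infLogRatio] at h
  obtain ⟨c, hc, r₀, hr⟩ := h
  have hpc0 : 0 < (criticalProbI 3 : ℝ) := pc_pos
  have hpc1 : (criticalProbI 3 : ℝ) < 1 := pc_lt_one
  set ε₀ : ℝ := (1 - (criticalProbI 3 : ℝ)) / 2 with hε₀_def
  have hε₀ : 0 < ε₀ := by rw [hε₀_def]; linarith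
  have hε₀1 : (criticalProbI 3 : ℝ) + ε₀ < 1 := by rw [hε₀_def]; linarith
  set p₁ : unitInterval := ⟨(criticalProbI 3 : ℝ) + ε₀, ⟨by linarith, hε₀1.le⟩⟩ with hp₁_def
  have hp₁ : criticalProbI 3 < p₁ := by
    rw [← Subtype.coe_lt_coe]
    show (criticalProbI 3 : ℝ) < (criticalProbI 3 : ℝ) + ε₀
    linarith
  -- anchor: eventually `log R_r(p₁)² < c/2`
  obtain ⟨r₁, hr₁⟩ := eventually_atTop.1
    ((tendsto_infLogRatio p₁ hp₁).eventually_lt_const (by linarith : (0 : ℝ) < c / 2))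
  refine ⟨ε₀, hε₀, hε₀1, c / 4, by linarith, max r₀ r₁, fun r hrr => ?_⟩
  have hlt : infLogRatio r ((criticalProbI 3 : ℝ) + ε₀) - infLogRatio r (criticalProbI 3 : ℝ) < -(c / 4) := by
    have h1 := hr r (le_of_max_le_left hrr)
    have h2 : infLogRatio r ((criticalProbI 3 : ℝ) + ε₀) < c / 2 := hr₁ r (le_of_max_le_right hrr)
    linarith
  obtain ⟨n₁, hn₁⟩ := eventually_atTop.1
    ((tendsto_integral_flowIntegrand r hpc0 (by linarith) hε₀1).eventually_lt_const hlt)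
  exact ⟨n₁, fun n hn => (hn₁ n hn).le⟩

/-- **The certificate.** The window pivotal deficit (box form of `stub_window`) is equivalent to
the crux `EquilateralAntiFactorisation`. -/
theorem window_iff_EquilateralAntiFactorisation :
    (∃ ε₀ : ℝ, 0 < ε₀ ∧ (criticalProbI 3 : ℝ) + ε₀ < 1 ∧ ∃ δ : ℝ, 0 < δ ∧ ∃ r₀ : ℕ, ∀ r : ℕ, r₀ ≤ r →
      ∃ n₀ : ℕ, ∀ n : ℕ, n₀ ≤ n →
        ∫ q in (criticalProbI 3 : ℝ)..((criticalProbI 3 : ℝ) + ε₀), flowIntegrand n r q ≤ -δ) ↔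
    Summit.CriticalPhenomena.PercolationContinuityZ3.Theses.PercTreeValue.EquilateralAntiFactorisation :=
  ⟨EquilateralAntiFactorisation_of_window, window_of_EquilateralAntiFactorisation⟩

/-! ### Tail localisation -/

/-- **Tail localisation (window shrinkage).** If the window statement holds for the window
`[p_c, p_c + ε₀]` with margin `δ`, it holds for every sub-window `[p_c, p_c + ε]`, `0 < ε ≤ ε₀`,
with any margin `δ' < δ`: the flow across `[p_c + ε, p_c + ε₀]` tends (box, then `r → ∞`) to
`log R_r(p_c+ε₀)² − log R_r(p_c+ε)² → 0` by the anchor at both points. So all the mass of the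
window deficit sits at `p_c⁺`, and every fixed-sub-window version of `stub_window` is again the crux. -/
theorem window_shrink {ε₀ δ : ℝ} (hε₀1 : (criticalProbI 3 : ℝ) + ε₀ < 1)
    (hW : ∃ r₀ : ℕ, ∀ r : ℕ, r₀ ≤ r → ∃ n₀ : ℕ, ∀ n : ℕ, n₀ ≤ n →
      ∫ q in (criticalProbI 3 : ℝ)..((criticalProbI 3 : ℝ) + ε₀), flowIntegrand n r q ≤ -δ)
    {ε : ℝ} (hε : 0 < ε) (hεle : ε ≤ ε₀) {δ' : ℝ} (hδ' : δ' < δ) :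
    ∃ r₀ : ℕ, ∀ r : ℕ, r₀ ≤ r → ∃ n₀ : ℕ, ∀ n : ℕ, n₀ ≤ n →
      ∫ q in (criticalProbI 3 : ℝ)..((criticalProbI 3 : ℝ) + ε), flowIntegrand n r q ≤ -δ' := by
  obtain ⟨r₀, hwin⟩ := hW
  have hpc0 : 0 < (criticalProbI 3 : ℝ) := pc_pos
  set η : ℝ := δ - δ' with hη_def
  have hη : 0 < η := by rw [hη_def]; linarith
  -- the two anchor parameters `p₁ = p_c + ε ≤ p₂ = p_c + ε₀` in `(p_c, 1)`
  set p₁ : unitInterval := ⟨(criticalProbI 3 : ℝ) + ε, ⟨by linarith, by linarith⟩⟩ with hp₁_def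
  set p₂ : unitInterval := ⟨(criticalProbI 3 : ℝ) + ε₀, ⟨by linarith, hε₀1.le⟩⟩ with hp₂_def
  have hp₁ : criticalProbI 3 < p₁ := by
    rw [← Subtype.coe_lt_coe]
    show (criticalProbI 3 : ℝ) < (criticalProbI 3 : ℝ) + ε
    linarith
  have hp₂ : criticalProbI 3 < p₂ := by
    rw [← Subtype.coe_lt_coe]
    show (criticalProbI 3 : ℝ) < (criticalProbI 3 : ℝ) + ε₀
    linarith
  obtain ⟨r₁, hr₁⟩ := eventually_atTop.1
    ((tendsto_infLogRatio p₁ hp₁).eventually_lt_const (by linarith : (0 : ℝ) < η / 2))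
  obtain ⟨r₂, hr₂⟩ := eventually_atTop.1
    ((tendsto_infLogRatio p₂ hp₂).eventually_const_lt (by linarith : -(η / 2) < (0 : ℝ)))
  refine ⟨max r₀ (max r₁ r₂), fun r hr => ?_⟩
  have hr0 : r₀ ≤ r := le_of_max_le_left hr
  have hr1 : r₁ ≤ r := le_of_max_le_left (le_of_max_le_right hr)
  have hr2 : r₂ ≤ r := le_of_max_le_right (le_of_max_le_right hr)
  obtain ⟨n₀, hn₀⟩ := hwin r hr0
  -- the tail flow `∫_{p_c+ε}^{p_c+ε₀} g_{n,r}` is eventually `> -η`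
  have htail_lim : -η < infLogRatio r ((criticalProbI 3 : ℝ) + ε₀) - infLogRatio r ((criticalProbI 3 : ℝ) + ε) := by
    have h1 : infLogRatio r ((criticalProbI 3 : ℝ) + ε) < η / 2 := hr₁ r hr1
    have h2 : -(η / 2) < infLogRatio r ((criticalProbI 3 : ℝ) + ε₀) := hr₂ r hr2
    linarith
  obtain ⟨n₁, hn₁⟩ := eventually_atTop.1
    ((tendsto_integral_flowIntegrand r (by linarith : 0 < (criticalProbI 3 : ℝ) + ε)
      (by linarith : (criticalProbI 3 : ℝ) + ε ≤ (criticalProbI 3 : ℝ) + ε₀) hε₀1).eventually_const_lt htail_lim)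
  refine ⟨max (max n₀ n₁) r, fun n hn => ?_⟩
  have hn0 : n₀ ≤ n := le_of_max_le_left (le_of_max_le_left hn)
  have hn1 : n₁ ≤ n := le_of_max_le_right (le_of_max_le_left hn)
  have hnr : r ≤ n := le_of_max_le_right hn
  -- interval additivity `∫_{p_c}^{p_c+ε} + ∫_{p_c+ε}^{p_c+ε₀} = ∫_{p_c}^{p_c+ε₀}` (continuity on `[p_c, p_c+ε₀]`)
  have hcont : ContinuousOn (flowIntegrand n r) (Set.Icc (criticalProbI 3 : ℝ) ((criticalProbI 3 : ℝ) + ε₀)) :=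
    continuousOn_flowIntegrand n r (fun q hq => evT_pos (hpc0.trans_le hq.1) (hq.2.trans hε₀1.le) hnr)
  have hI₁ : IntervalIntegrable (flowIntegrand n r) volume (criticalProbI 3 : ℝ) ((criticalProbI 3 : ℝ) + ε) := by
    refine ContinuousOn.intervalIntegrable ?_
    rw [Set.uIcc_of_le (by linarith)]
    exact hcont.mono (Set.Icc_subset_Icc le_rfl (by linarith))
  have hI₂ : IntervalIntegrable (flowIntegrand n r) volume ((criticalProbI 3 : ℝ) + ε) ((criticalProbI 3 : ℝ) + ε₀) := by
    refine ContinuousOn.intervalIntegrable ?_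
    rw [Set.uIcc_of_le (by linarith)]
    exact hcont.mono (Set.Icc_subset_Icc (by linarith) le_rfl)
  have hadd := intervalIntegral.integral_add_adjacent_intervals hI₁ hI₂
  have hwhole := hn₀ n hn0
  have htail := hn₁ n hn1
  linarith

end Summit.CriticalPhenomena.PercolationContinuityZ3.Theorems.EquilateralAntiFactorisation.Flow

end
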